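import Summits.QuantumFields.YangMills.Theorems.BalabanUVNodesN16HolderDefs
import Summits.QuantumFields.YangMills.Theorems.BalabanUVNodesN16HolderEndSfClass
import Summits.QuantumFields.YangMills.Theorems.BalabanUVNodesN16ConstantOfRecord
import HarnessLib

/-!
# Route «BalabanUVNodes», cluster K4 «SpineRates» — node N16 = NE3: THE END AT HÖLDER EXPONENT `β` WITH ITS CONSTANT DISPLAYED AND UNIFORM —
# `N16's CONSTANT OF RECORD` (`Thm/BalabanUVNodesN16ConstantOfRecord`) with the B8 shape `PairLandauGaugeB8Avg … s₁ s₂ β dom` and the β-root `CovRootHolder` as conclusion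

Cell `pub-ymgap`, seat `pub-ymgap-dag-n16-c` (R134 fan-out seat, strategy s1; HUMAN RULING D-0062; chair R424 venue), generation 3, file 12 — module (B) of
the producer column of repair R-β of the located item «the Hölder-exponent pin of N16's N05-socket» (`HOME/pub-ymgap-dag-n16-c/LOCATED-N16-HOLDER-PIN.md`;
pub-ymgap INBOX DAGN16C-G3-INTENT-1); over file 11 `…N16HolderDefs` (`CovRootHolder`, p478789), generation 2's junction `…N16HolderEnd` (p474011) and
n16-a's `…N16ConstantOfRecord` (p416870: `endConst_le`, `CPLine_pos`).  `--supports stmt-QuantumFields-19908` (helper).  `bears_on: R4∕N16 · edge N05 → N16`.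

WHY.  The chain of record above THE END (`n16_constant_of_record` → `n16_of_thm4Output` → … → `n16_of_b8LeafRS`) starts from `…N16ConstantOfRecord`: THE END with
its constant majorised by a closed term `C⋆(d, L, card n, CP, g)` free of `(ε, s₁, b, s₂, dom)`, so that `∃ C` stands right after `∀ g`.  That file reads the B8
shape at `β := 1`.  Generation 2's END at exponent `β` (`…N16HolderEndSfClass`) has `∃ C` LAST (not uniform).  THIS FILE is `…N16ConstantOfRecord` §2–§5 with
`1 ↦ β`: same `r`, same displayed `C⋆` — both are β-free — and the β-root `CovRootHolder … C⋆ s₁ s₂ β dom` as conclusion, `β` quantified INSIDE (after `∃ C`),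
so ONE `(r, C)` serves every exponent, in particular a printed `β₀ < 1` AND the exponent of record `β = 1` (`N16HolderDefs.covRootHolder_one_iff`).

WHAT THIS FILE PROVES (kernel, theorems only, 0 `def`, 0 sorry):
§0 `covRootHolder_of_pairLandauGaugeB8Avg` — generation 2's junction `N16HolderEnd.covRoot_holder_of_pairLandauGaugeB8Avg` concluding BY THE NAME `CovRootHolder`
   (constant displayed: `(1 + (ν + 23√2·√(16d+1)·(1+ν)))·(4∕cΛ)·C′`).
§1 `covRootHolder_sfClass_small_const` — THE END over `sfClass` at exponent `β`, numeric lines discharged (`endLines_exists`), constant `C⋆` displayed (`endConst_le`).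
§2 `covRootHolder_sfClass_small_of_leafH3sup_const` — the sup letter `hF5` traded for N07's `LeafH3sup` (`hF5_of_leafH3sup`), same constant.
§3 `covRootHolder_sfClass_small_of_lines_const` — (P♮) by the owner's four k-free lines (`slicePoincare_slicB8_cavg_of_regular`, `CPLine_pos`), `∃ C ≥ 0` right after `∀ g`.
§4 `n16_holder_constant_of_record` (`d = 4`): `∃ r > 0, ∀ g > 0, ∃ C ≥ 0, ∀ b′ c′ … ε s₁ b … s₂ β dom, PairLandauGaugeB8Avg 4 (sfClass 4 L N ε) L N b g s₁ s₂ β dom →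
   LeafH3sup 4 L N ε b′ c′ dom → CovRootHolder 4 (sfClass 4 L N ε) L N b g C s₁ s₂ β dom`; at `β := 1` this is `n16_constant_of_record` (`covRootHolder_one_iff`).
HONEST FRAMING: binder bookkeeping over LANDED theorems by name (their estimates); the N05 interface `PairLandauGaugeB8Avg … β` ([Balaban1985RegularSpaces] Thm 2 +
(1.37) ∘ [Balaban1985Variational] Thm 1 TYPE at the pairs, Hölder member at its PRINTED exponent «β ≦ β₀ < 1») and the N07 interface `LeafH3sup` ([Balaban1985Variational]
Thm 1 (8)+(10) TYPE) remain HYPOTHESES; nothing of Bałaban's proved; **N16 ∕ NE3 NOT discharged**; the repair's statement edit is the planner's; count-neutral;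
one finite four-torus at fixed ε — NOT ℝ⁴, NOT infinite volume, NOT OS, NOT a mass gap, NOT Clay.
-/

set_option autoImplicit false

open scoped BigOperators Matrix Matrix.Norms.L2Operator
open NormedSpace Finset

namespace Summit.QuantumFields.YangMills.BalabanUVNodes.N16HolderConst

open Set
open Literature.MathematicalPhysics.QuantumFieldTheory.Balaban1983to89
open B7Prop1Explicit B7Prop2Explicit
open T4AveragingDeficitWall (IsSkewDir IsUnitaryCfg SmallField Ad vary Plane)
open T4AveragingDeficitWallBoundary (IsPeriodicCfg periodBox)
open Summit.QuantumFields.BalabanUV.T4Continuum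
open AveragingDeficitPeriodicCounting (IsPeriodicDir)
open AveragingDeficitChartCalculus (cavg)
open AveragingDeficitMultiLevelPrep (LevelSmall)
open AveragingDeficitTwoLevelPrep (twoLevelSmall)
open MinimalActionSandwich (IsMinimiser)
open MinimalActionRate (Regular sfClass)
open NE3EnergyShapes (residualScale IsUnitarySite IsPeriodicSite)
open NE3EnergyWeightedShapes (energyNormW CurlPairedResidual)
open NE3SlicePoincareShape (SlicePoincare)
open NE3EnergyRateWSupOfSlicePoincare (cLambda cLambda_pos)
open NE3QbarIterCovLiftPrep (cruxC liftC liftC_nonneg)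
open NE3RightInverseSolveLetters (thetaLoc cruxC_nonneg)
open NE3RightInverseSupLetters (frameC)
open NE3ClassRadiusFamily (levelSmall_family)
open NE3EnergyChartLeaves (isUnitaryCfg_cavg_of_regular)
open NE3CurlPairedResidualGaugeQuotient (curlPairedResidual_sfClass_of_tangentProjection)
open NE3ProductPath (pathΓ)
open NE3ProductPathChartSlice (DecomposedRepT)
open NE3SlicePoincareBudgetLine (CPLine ShLine SmallYLine)
open NE3CovariantLineSumsL2 (C2sq)
open NE3CovariantLineSumsL2Tower (rho)
open NE3.PairLandauB8Avg (LandauRepB8Avg PairLandauGaugeB8Avg slicB8)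
open NE3.LandauProjectionSupShape (LandauCorrectionSupB8)
open NE3.SupplierB8SfClassSizes (decomposedRepT_sfClass_of_landauRepB8Avg_towers)
open NE3.TangentProjectionSlicB8Class (tangentProjectionBound_slicB8_sfClass_family)
open NE3.EndLinesNonVacuous (endLines_exists)
open NE3.LeafIndexSockets (LeafH3sup)
open NE3.PairLandauB8EndSupFacts (cruxC_eps_le_half supFacts_const_le)
open NE3.SupRegularityCurvedUniform (one_le_frameC_add)
open NE3.PairLandauB8EndSfClassH3sup (hF5_of_leafH3sup)
open NE3.SlicePoincareCoulombN (CPLine_nonneg)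
open NE3.PairLandauB8EndSfClassHP (slicePoincare_slicB8_cavg_of_regular ownerLines_exist)
open BlockAverageCurrent (curConst curConst_nonneg)
open Summit.QuantumFields.YangMills.BalabanUVNodes.N16HolderEnd (covRoot_holder_of_pairLandauGaugeB8Avg)
open Summit.QuantumFields.YangMills.BalabanUVNodes.N16HolderDefs (CovRootHolder)
open Summit.QuantumFields.YangMills.BalabanUVNodes.N16 (endConst_le CPLine_pos)

noncomputable section

variable {d : ℕ} {n : Type*} [Fintype n] [DecidableEq n]

/-! ## §0 Generation 2's junction, concluding by the name `CovRootHolder` -/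

/-- **THE END's JUNCTION ON [B8]'s SURFACE AT EXPONENT `β`, NAMED** (class-generic; `d ≥ 1`, `L, N ≥ 1`): `N16HolderEnd.covRoot_holder_of_pairLandauGaugeB8Avg`
VERBATIM — `PairLandauGaugeB8Avg d 𝒞 L N b g s₁ s₂ β dom` ∧ (per pair, per B8 representative) `DecomposedRepT` on `slicB8` starting at the B8 direction ∧ (P♮)∕(RES♯) on
`slicB8` ∧ the k-free letters ⟹ `CovRootHolder d 𝒞 L N b g ((1 + (ν + 23√2·√(16d+1)·(1+ν)))·(4∕cΛ)·C′) s₁ s₂ β dom` (`Λ₁ = s₁`, `Λ₂′ = s₂`).  The inline conclusion of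
the junction is `CovRootHolder` unfolded. [folklore] -/
theorem covRootHolder_of_pairLandauGaugeB8Avg [Nonempty n] (hd : 1 ≤ d) {𝒞 : ℕ → _root_.Set (Site d → Fin d → (Matrix n n ℂ)ˣ)}
    {L N : ℕ} (hL : 1 ≤ L) (hN : 1 ≤ N) {b g s₁ s₂ β : ℝ} {dom : _root_.Set (Site d → Fin d → (Matrix n n ℂ)ˣ)}
    {ν κ₁ κ₂ CP Λ C' : ℝ} (hCP : 0 ≤ CP) (hreg₁ : CP * (Real.sqrt Λ - 1) ^ 2 ≤ 1 / 4) (hν : 0 ≤ ν) (hC' : 0 ≤ C')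
    (hbudget : 2 * Λ * (2 * (1 + 4 * Real.sqrt (16 * d + 1)) * ν) + Λ * (2 * (1 + 4 * Real.sqrt (16 * d + 1)) * ν) ^ 2
        + (2 * κ₁ + 912 * d * κ₂) ≤ cLambda n CP Λ / 2)
    (hB8 : PairLandauGaugeB8Avg d 𝒞 L N b g s₁ s₂ β dom)
    (hsupp : ∀ k : ℕ, 1 ≤ k → ∀ V ∈ dom, ∀ UA UB : Site d → Fin d → (Matrix n n ℂ)ˣ,
      IsMinimiser d 𝒞 L N k V UA → IsMinimiser d 𝒞 L N (k + 1) V UB → Regular d L N b g (k + 1) UB →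
      ∀ (u : Site d → (Matrix n n ℂ)ˣ) (Z : Site d → Fin d → Matrix n n ℂ), LandauRepB8Avg L N k (cavg L UB) UA u Z s₁ s₂ β →
        IsUnitaryCfg (cavg L UB) ∧
        ∃ (X Nn : Site d → Fin d → Matrix n n ℂ) (α αN a : ℝ),
          DecomposedRepT 𝒞 L N k V UA UB u X Nn (slicB8 L N k (cavg L UB)) α αN ν κ₁ κ₂ a ∧
          pathΓ X Nn 0 = Z ∧ α ≤ 1 / 40 ∧ αN ≤ 1 / 100 ∧
          (1 + 24 * Real.sqrt d * (Real.exp (10 * (α + αN)) - 1) * (L : ℝ) ^ k) ^ 2 + 48 * d * a * ((L : ℝ) ^ k) ^ 2 ≤ Λ ∧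
          112 * (d : ℝ) * a * CP * ((L : ℝ) ^ k) ^ 2 ≤ 1 / (2 * (Fintype.card n : ℝ)) ∧
          SlicePoincare L k (cavg L UB) (slicB8 L N k (cavg L UB)) CP (periodBox (N * L ^ k)) ∧
          CurlPairedResidual L k (cavg L UB) (slicB8 L N k (cavg L UB)) (C' * residualScale d L N b g k) (periodBox (N * L ^ k))) :
    CovRootHolder d 𝒞 L N b g ((1 + (ν + 23 * Real.sqrt 2 * Real.sqrt (16 * d + 1) * (1 + ν))) * (4 / cLambda n CP Λ) * C') s₁ s₂ β dom :=
  covRoot_holder_of_pairLandauGaugeB8Avg hd hL hN hCP hreg₁ hν hC' hbudget hB8 hsupp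

/-! ## §1 THE END at exponent `β` with its constant displayed, uniform in `(ε, s₁, b, s₂, β, dom)` (slice constant `CP > 0`) -/

/-- **THE END ON B8's SURFACE OVER `sfClass` AT HÖLDER EXPONENT `β`, NUMERIC LINES DISCHARGED, ITS CONSTANT DISPLAYED AND FREE OF `(ε, s₁, b, s₂, β, dom)`** —
`N16.ne3EnergyRateWCov_sfClass_small_const` with `1 ↦ β`: for `3 ≤ d`, `2 ≤ L`, `1 ≤ N`, `CP > 0`, `K₀, K₁ ≥ 0` there is `r > 0` such that for every `g > 0`, all
`0 < ε ≤ r`, `0 ≤ s₁ ≤ r`, `0 ≤ b ≤ ε∕2`, `s₂`, `β`, `dom`: `PairLandauGaugeB8Avg d (sfClass d L N ε) L N b g s₁ s₂ β dom` ∧ per-pair `LandauCorrectionSupB8 (K₀, K₁)` ∧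
per-pair (P♮) on `slicB8` ⟹ `CovRootHolder d (sfClass d L N ε) L N b g C⋆ s₁ s₂ β dom`, `C⋆ = C⋆(d, L, card n, CP, g)` the term displayed below (`endLines_exists` +
generation 2's per-pair chain BY NAME + §0 + `endConst_le` + `CovRootHolder.mono`). [folklore] -/
theorem covRootHolder_sfClass_small_const [Nonempty n] (hd : 3 ≤ d) {L N : ℕ} [NeZero L] [NeZero N] (hL : 2 ≤ L) (hN : 1 ≤ N)
    {CP K₀ K₁ : ℝ} (hCP : 0 < CP) (hK₀ : 0 ≤ K₀) (hK₁ : 0 ≤ K₁) :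
    ∃ r : ℝ, 0 < r ∧ ∀ ⦃g : ℝ⦄, 0 < g → ∀ ⦃ε s₁ b : ℝ⦄, 0 < ε → ε ≤ r → 0 ≤ s₁ → s₁ ≤ r → 0 ≤ b → b ≤ ε / 2 →
      ∀ (s₂ β : ℝ) {dom : _root_.Set (Site d → Fin d → (Matrix n n ℂ)ˣ)},
        PairLandauGaugeB8Avg d (sfClass d L N ε) L N b g s₁ s₂ β dom →
        (∀ j : ℕ, ∀ V ∈ dom, ∀ UB : Site d → Fin d → (Matrix n n ℂ)ˣ, IsMinimiser d (sfClass d L N ε) L N (j + 2) V UB → Regular d L N b g (j + 2) UB → ∀ (hWu : IsUnitaryCfg (cavg L UB)) (hx : 0 ≤ ε / ((L : ℝ) ^ (j + 1)) ^ 2) (hs : LevelSmall d L j (ε / ((L : ℝ) ^ (j + 1)) ^ 2)) (hWx : SmallField (cavg L UB) (ε / ((L : ℝ) ^ (j + 1)) ^ 2)) (hθ : cruxC d L * (((L : ℝ) ^ (j + 1)) ^ 2 * (ε / ((L : ℝ) ^ (j + 1)) ^ 2)) < 1), LandauCorrectionSupB8 hL j hWu hx hs hWx N hθ K₀ K₁)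 →
        (∀ j : ℕ, ∀ V ∈ dom, ∀ UB : Site d → Fin d → (Matrix n n ℂ)ˣ, IsMinimiser d (sfClass d L N ε) L N (j + 2) V UB → Regular d L N b g (j + 2) UB → SlicePoincare L (j + 1) (cavg L UB) (slicB8 L N (j + 1) (cavg L UB)) CP (periodBox (N * L ^ (j + 1)))) →
        CovRootHolder d (sfClass d L N ε) L N b g
          ((1 + ((1 + 2048 * Real.sqrt (16 * d + 1)) + 23 * Real.sqrt 2 * Real.sqrt (16 * d + 1) * (1 + (1 + 2048 * Real.sqrt (16 * d + 1)))))
          * (8 * (Fintype.card n : ℝ) * (1 + 4 * CP) * (8 + 1 / (2 * CP)))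
          * ((1 + Real.sqrt (192 * ((d : ℝ) * L) * (d + Fintype.card (T4AveragingDeficitWall.Plane d))))
            * (Real.sqrt ((L : ℝ) ^ (d - 2))
              + (Real.sqrt ((L : ℝ) ^ (d - 2)) * Real.sqrt (8 * Fintype.card (T4AveragingDeficitWall.Plane d)) * (128 * (d * (L : ℝ) ^ 2))
                  + 2 * (2048 * ((d : ℝ) + 4) ^ 2 * (L : ℝ) ^ 2 * Real.sqrt (d * (L : ℝ) ^ d))) / 2
              + (2 * (L : ℝ) ^ (d - 1) + 2 * (8 * d * (L : ℝ) ^ d)) * Real.sqrt (d / (g * (L : ℝ) ^ (d + 2))) / 4)))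
          s₁ s₂ β dom := by
  obtain ⟨r, hr0, hr⟩ := endLines_exists (n := n) d L N (le_trans (by norm_num) hL) K₀ K₁ hCP.le
  refine ⟨r, hr0, fun g hg ε s₁ b hε hεr hs₁ hs₁r hb hbh s₂ β dom hB8 hF5 hP => ?_⟩
  obtain ⟨α₀, P, Q, AN, Ac, ah, Λ, hbε, hε1, hbs, hbε', h1, h2, hθε, hθlε, hPsε, hα, hα3, hα4, hεα, hsmall, hc₃, hK, hS1, hP0, hQ0,
    hPl, hQl, hAN, hAc, hah, hlines₁, hlineJ, hlineN, hlineα, hlineαN, hρ, hlineΛ, hlineCP, hreg₁, hbudget⟩ :=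
    hr hε hεr hs₁ hs₁r hb hbh
  have hε0 : 0 ≤ ε := hε.le; have hL1 : 1 ≤ L := le_trans one_le_two hL; have hd1 : 1 ≤ d := le_trans (by norm_num) hd
  -- the letter `ν` of the towers chain (verbatim `…N16HolderEndSfClass` §1)
  have hν : 0 ≤ ((1 + 2048 * Real.sqrt (16 * d + 1)) * (2 * Real.sqrt ((2 * (liftC d / (1 - thetaLoc d L * ε)) ^ 2 + 8 * Fintype.card n * ((d : ℝ) * liftC d ^ 2 * (2 * (d : ℝ) + 8) ^ 2 / (1 - thetaLoc d L * ε) ^ 2)) + (2 * (4 * d * (liftC d * (17 + 16 * (d : ℝ))) ^ 2 / (1 - thetaLoc d L * ε) ^ 2) + 128 * Fintype.card (T4AveragingDeficitWall.Plane d) * Fintype.card n * ((d : ℝ) * liftC d ^ 2 * (2 * (d : ℝ) + 8) ^ 2 / (1 - thetaLoc d L * ε) ^ 2))) * P * s₁)) := by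
    have hlC := liftC_nonneg d
    have h1' : 0 ≤ 1 + 2048 * Real.sqrt (16 * (d : ℝ) + 1) := by positivity
    have h2' : 0 ≤ 2 * Real.sqrt ((2 * (liftC d / (1 - thetaLoc d L * ε)) ^ 2 + 8 * Fintype.card n * ((d : ℝ) * liftC d ^ 2 * (2 * (d : ℝ) + 8) ^ 2 / (1 - thetaLoc d L * ε) ^ 2)) + (2 * (4 * d * (liftC d * (17 + 16 * (d : ℝ))) ^ 2 / (1 - thetaLoc d L * ε) ^ 2) + 128 * Fintype.card (T4AveragingDeficitWall.Plane d) * Fintype.card n * ((d : ℝ) * liftC d ^ 2 * (2 * (d : ℝ) + 8) ^ 2 / (1 - thetaLoc d L * ε) ^ 2))) := by positivity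
    exact mul_nonneg h1' (mul_nonneg (mul_nonneg h2' hP0) hs₁)
  -- the constant of (RES♯) through the gauge quotient
  have hC0 : 0 ≤ Real.sqrt ((L : ℝ) ^ (d - 2))
      + (Real.sqrt ((L : ℝ) ^ (d - 2)) * Real.sqrt (8 * Fintype.card (T4AveragingDeficitWall.Plane d))
          * (128 * (d * (L : ℝ) ^ 2))
        + 2 * (2048 * ((d : ℝ) + 4) ^ 2 * (L : ℝ) ^ 2 * Real.sqrt (d * (L : ℝ) ^ d))) * b
      + b ^ 2 * (2 * (L : ℝ) ^ (d - 1) + 2 * (8 * d * (L : ℝ) ^ d)) * Real.sqrt (d / (g * (L : ℝ) ^ (d + 2))) := by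
    positivity
  have hK25 : 0 ≤ 1 + Real.sqrt (192 * ((d : ℝ) * L) * (d + Fintype.card (T4AveragingDeficitWall.Plane d))) := by positivity
  have hC' := mul_nonneg hK25 hC0
  have hsmallLv : ∀ j : ℕ, LevelSmall d L (j + 1) (ε / ((L : ℝ) ^ (j + 2)) ^ 2) := levelSmall_family hL hε0 h1 h2
  have hb2 : b ≤ 1 / 2 := by linarith
  refine (covRootHolder_of_pairLandauGaugeB8Avg hd1 hL1 hN hCP.le hreg₁ hν hC' hbudget hB8 ?_).mono
    (endConst_le (n := n) ?_ ?_ ?_ hP0 hs₁ hCP ?_ ?_ ?_ ?_ ?_ hb hb2 hρ hreg₁) le_rfl le_rfl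
  · intro k hk V hV UA UB hA hB hreg u Z hZ
    obtain ⟨j, rfl⟩ : ∃ j, k = j + 1 := ⟨k - 1, by omega⟩
    have hW : IsUnitaryCfg (cavg L UB) := isUnitaryCfg_cavg_of_regular hL1 j hb hbε (hsmallLv j) hreg
    obtain ⟨X, Nn, α, αN, a, hdec, hΓ0, hα40, hαN100, hJ1, hJ2⟩ :=
      decomposedRepT_sfClass_of_landauRepB8Avg_towers hd hL hN hb hε0 hε1 hbs hbε' h1 h2 hθε hθlε hPsε hα hα3 hα4 hεα hs₁ hsmall hc₃ hK hS1 hP0 hQ0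
        hPl hQl hK₀ hK₁ hCP.le hAN hAc hah hlines₁ hlineJ hlineN hlineα hlineαN hρ hlineΛ hlineCP j hA hB hreg hZ (hF5 j V hV UB hB hreg)
    have hproj := tangentProjectionBound_slicB8_sfClass_family hd hL hN hb hε0 hε1 hbs hbε' h1 h2 j hreg
    have hres := curlPairedResidual_sfClass_of_tangentProjection (le_trans (by norm_num) hd) hL1 hN j hb hbε hg (hsmallLv j) hB hreg hproj
    rw [← mul_assoc] at hres
    exact ⟨hW, X, Nn, α, αN, a, hdec, hΓ0, hα40, hαN100, hJ1, hJ2, hP j V hV UB hB hreg, hres⟩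
  all_goals positivity

/-! ## §2 `hF5` traded for N07's interface (H3ˢᵘᵖ) — the constant threaded, at exponent `β` -/

/-- **THE END AT EXPONENT `β` WITH THE SUP LETTER GONE, SAME DISPLAYED CONSTANT** — `N16.ne3EnergyRateWCov_sfClass_small_of_leafH3sup_const` with `1 ↦ β` (same
proof: the uniform majorants `K₀*`, `K₁*` are closed terms in `(d, L, N, card n)` and do not enter the constant): `∃ r > 0, ∀ g > 0, ∀` leaf letters `0 ≤ b′, c′` on
(Rb) and the `c′`-line, `∀ 0 < ε ≤ r, 0 ≤ s₁ ≤ r, 0 ≤ b ≤ ε∕2, ∀ s₂ β dom`: `PairLandauGaugeB8Avg d (sfClass d L N ε) L N b g s₁ s₂ β dom` ∧ `LeafH3sup d L N ε b′ c′ dom`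
∧ per-pair (P♮) on `slicB8` with constant `CP > 0` ⟹ `CovRootHolder d (sfClass d L N ε) L N b g C⋆ s₁ s₂ β dom`. [folklore] -/
theorem covRootHolder_sfClass_small_of_leafH3sup_const [Nonempty n] (hd : 3 ≤ d) {L N : ℕ} [NeZero L] [NeZero N] (hL : 2 ≤ L)
    (hN : 1 ≤ N) {CP : ℝ} (hCP : 0 < CP) :
    ∃ r : ℝ, 0 < r ∧ ∀ ⦃g : ℝ⦄, 0 < g → ∀ ⦃b' c' : ℝ⦄, 0 ≤ b' → 0 ≤ c' →
      2 ^ 15 * ((d : ℝ) + 1) ^ 2 * ((d : ℝ) + 4) ^ 2 * (L : ℝ) ^ 2 * b' ≤ 1 →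
      23040 * (d : ℝ) ^ 4 * (frameC d L + d) ^ 3 * (c' + curConst d L * b' ^ 2) ≤ 1 → ∀ ⦃ε s₁ b : ℝ⦄, 0 < ε → ε ≤ r → 0 ≤ s₁ → s₁ ≤ r → 0 ≤ b → b ≤ ε / 2 →
      ∀ (s₂ β : ℝ) {dom : _root_.Set (Site d → Fin d → (Matrix n n ℂ)ˣ)},
        PairLandauGaugeB8Avg d (sfClass d L N ε) L N b g s₁ s₂ β dom →
        LeafH3sup d L N ε b' c' dom →
        (∀ j : ℕ, ∀ V ∈ dom, ∀ UB : Site d → Fin d → (Matrix n n ℂ)ˣ, IsMinimiser d (sfClass d L N ε) L N (j + 2) V UB → Regular d L N b g (j + 2) UB →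
          SlicePoincare L (j + 1) (cavg L UB) (slicB8 L N (j + 1) (cavg L UB)) CP (periodBox (N * L ^ (j + 1)))) →
        CovRootHolder d (sfClass d L N ε) L N b g
          ((1 + ((1 + 2048 * Real.sqrt (16 * d + 1)) + 23 * Real.sqrt 2 * Real.sqrt (16 * d + 1) * (1 + (1 + 2048 * Real.sqrt (16 * d + 1)))))
          * (8 * (Fintype.card n : ℝ) * (1 + 4 * CP) * (8 + 1 / (2 * CP)))
          * ((1 + Real.sqrt (192 * ((d : ℝ) * L) * (d + Fintype.card (T4AveragingDeficitWall.Plane d))))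
            * (Real.sqrt ((L : ℝ) ^ (d - 2))
              + (Real.sqrt ((L : ℝ) ^ (d - 2)) * Real.sqrt (8 * Fintype.card (T4AveragingDeficitWall.Plane d)) * (128 * (d * (L : ℝ) ^ 2))
                  + 2 * (2048 * ((d : ℝ) + 4) ^ 2 * (L : ℝ) ^ 2 * Real.sqrt (d * (L : ℝ) ^ d))) / 2
              + (2 * (L : ℝ) ^ (d - 1) + 2 * (8 * d * (L : ℝ) ^ d)) * Real.sqrt (d / (g * (L : ℝ) ^ (d + 2))) / 4)))
          s₁ s₂ β dom := by
  have hd1 : 1 ≤ d := le_trans (by norm_num) hd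
  -- the level-free constant and the uniform majorants `K₀*`, `K₁*` of `K₀(ε)`, `K₁(ε)` (verbatim `…N16ConstantOfRecord` §3)
  obtain ⟨cR, hcR⟩ : ∃ K : ℝ, K = 1 + 2 * (Fintype.card n : ℝ) * (64 * (d : ℝ) ^ 2 * N) ^ d + 27 * (Fintype.card n : ℝ) ^ 3 * (512 : ℝ) ^ d * (N : ℝ) ^ d := ⟨_, rfl⟩
  have hcR0 : 0 ≤ cR := by rw [hcR]; positivity
  have hF0 : 0 ≤ frameC d L + d := le_trans zero_le_one (one_le_frameC_add hd1 L)
  obtain ⟨K₀s, hK₀s⟩ : ∃ K : ℝ, K = 2 * ((d : ℝ) * liftC d * (36 * d * (frameC d L + d) ^ 2) * cR * (6 + 2 * ((d : ℝ) + 1))) := ⟨_, rfl⟩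
  obtain ⟨K₁s, hK₁s⟩ : ∃ K : ℝ, K = 2 * ((d : ℝ) * liftC d * (36 * d * (frameC d L + d)) * cR * (6 + 2 * ((d : ℝ) + 1))) := ⟨_, rfl⟩
  have hK₀ : 0 ≤ K₀s := by rw [hK₀s]; have := liftC_nonneg d; positivity
  have hK₁ : 0 ≤ K₁s := by rw [hK₁s]; have := liftC_nonneg d; positivity
  obtain ⟨r, hr0, hr⟩ := covRootHolder_sfClass_small_const (n := n) hd hL hN (CP := CP) hCP hK₀ hK₁
  have hc := cruxC_nonneg d L
  have hρ0 : 0 < 1 / (2 * cruxC d L + 2) := by positivity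
  have hd0 : (0 : ℝ) < d := by exact_mod_cast hd1
  have hF1 : (1 : ℝ) ≤ frameC d L + d := one_le_frameC_add hd1 L
  have hF2 : 0 < 23040 * (d : ℝ) ^ 4 * (frameC d L + d) ^ 2 := by positivity
  have hσ0 : 0 < 1 / (23040 * (d : ℝ) ^ 4 * (frameC d L + d) ^ 2) := by positivity
  refine ⟨min r (min (1 / (2 * cruxC d L + 2)) (1 / (23040 * (d : ℝ) ^ 4 * (frameC d L + d) ^ 2))), lt_min hr0 (lt_min hρ0 hσ0),
    fun g hg b' c' hb' hc' hRb hcF ε s₁ b hε hεr hs₁ hs₁r hb hbh s₂ β dom hB8 h3 hP => ?_⟩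
  have hεr' : ε ≤ r := hεr.trans (min_le_left _ _); have hs₁r' : s₁ ≤ r := hs₁r.trans (min_le_left _ _)
  obtain ⟨hcε, hε1⟩ := cruxC_eps_le_half d L hε.le (hεr.trans ((min_le_right _ _).trans (min_le_left _ _)))
  have hεF : 23040 * (d : ℝ) ^ 4 * (frameC d L + d) ^ 2 * ε ≤ 1 := by
    have h1 : ε ≤ 1 / (23040 * (d : ℝ) ^ 4 * (frameC d L + d) ^ 2) := hεr.trans ((min_le_right _ _).trans (min_le_right _ _))
    rw [le_div_iff₀ hF2] at h1; linarith
  -- `K(ε) ≤ K*`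
  have hle₀ : (d : ℝ) * liftC d * (6 + 2 * ((d : ℝ) + 1) * ε) * (36 * d * (frameC d L + d) ^ 2)
        * (1 + 2 * (Fintype.card n : ℝ) * (64 * (d : ℝ) ^ 2 * N) ^ d + 27 * (Fintype.card n : ℝ) ^ 3 * (512 : ℝ) ^ d * (N : ℝ) ^ d) / (1 - cruxC d L * ε) ≤ K₀s := by
    rw [← hcR, hK₀s]
    have hA : 0 ≤ (d : ℝ) * liftC d * (36 * d * (frameC d L + d) ^ 2) * cR := by have := liftC_nonneg d; positivity
    have key := supFacts_const_le d L hA hε.le hε1 hcε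
    calc (d : ℝ) * liftC d * (6 + 2 * ((d : ℝ) + 1) * ε) * (36 * d * (frameC d L + d) ^ 2) * cR / (1 - cruxC d L * ε)
        = (d : ℝ) * liftC d * (36 * d * (frameC d L + d) ^ 2) * cR * (6 + 2 * ((d : ℝ) + 1) * ε) / (1 - cruxC d L * ε) := by ring
      _ ≤ 2 * ((d : ℝ) * liftC d * (36 * d * (frameC d L + d) ^ 2) * cR * (6 + 2 * ((d : ℝ) + 1))) := key
  have hle₁ : (d : ℝ) * liftC d * (6 + 2 * ((d : ℝ) + 1) * ε) * (36 * d * (frameC d L + d))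
        * (1 + 2 * (Fintype.card n : ℝ) * (64 * (d : ℝ) ^ 2 * N) ^ d + 27 * (Fintype.card n : ℝ) ^ 3 * (512 : ℝ) ^ d * (N : ℝ) ^ d) / (1 - cruxC d L * ε) ≤ K₁s := by
    rw [← hcR, hK₁s]
    have hA : 0 ≤ (d : ℝ) * liftC d * (36 * d * (frameC d L + d)) * cR := by have := liftC_nonneg d; positivity
    have key := supFacts_const_le d L hA hε.le hε1 hcε
    calc (d : ℝ) * liftC d * (6 + 2 * ((d : ℝ) + 1) * ε) * (36 * d * (frameC d L + d)) * cR / (1 - cruxC d L * ε)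
        = (d : ℝ) * liftC d * (36 * d * (frameC d L + d)) * cR * (6 + 2 * ((d : ℝ) + 1) * ε) / (1 - cruxC d L * ε) := by ring
      _ ≤ 2 * ((d : ℝ) * liftC d * (36 * d * (frameC d L + d)) * cR * (6 + 2 * ((d : ℝ) + 1))) := key
  exact hr hg hε hεr' hs₁ hs₁r' hb hbh s₂ β hB8 (hF5_of_leafH3sup hd1 hL h3 hb' hc' hRb hεF hcF hle₀ hle₁) hP

/-! ## §3 (P♮) proved under the owner's four k-free lines (their slice constant is positive), at exponent `β` -/

/-- **THE END AT EXPONENT `β` WITH THE SLICE-POINCARÉ BINDER GONE, `∃ C ≥ 0` RIGHT AFTER `∀ g`** — `N16.ne3EnergyRateWCov_sfClass_small_of_lines_const` with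
`1 ↦ β` (same proof; the owner's slice constant `CP = 4·card n·(69 + 2δ_W)·CPLine` is POSITIVE, `CPLine_pos`) over §2 (`3 ≤ d`, `2 ≤ L`, `1 ≤ N`; the four k-free
lines on `(θ, εc) > 0`); `β` quantified after `∃ C`: ONE `(r, C)` for every exponent. [folklore] -/
theorem covRootHolder_sfClass_small_of_lines_const [Nonempty n] (hd : 3 ≤ d) {L N : ℕ} [NeZero L] [NeZero N] (hL : 2 ≤ L) (hN : 1 ≤ N)
    {θ εc : ℝ} (hθ : 0 < θ) (hεc : 0 < εc)
    (h1 : ShLine d L (Fintype.card n) εc θ ≤ 1 / 2) (h2 : SmallYLine d L (Fintype.card n) εc θ ≤ 1 / 2)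
    (h3 : 68 / 3 * (((d : ℝ) + 1) * ((d : ℝ) + 4)) * C2sq d L * θ ≤ rho d L / 2)
    (h4 : 8 * d * (((d : ℝ) - 1) * θ) ^ 2
      + 2 * ((Fintype.card n : ℝ) * ((4 * (d : ℝ) ^ 2 + 272 * d * (((d : ℝ) + 1) * ((d : ℝ) + 4))) * θ) ^ 2) ≤ 1 / 2) :
    ∃ r : ℝ, 0 < r ∧ ∀ ⦃g : ℝ⦄, 0 < g → ∃ C : ℝ, 0 ≤ C ∧ ∀ ⦃b' c' : ℝ⦄, 0 ≤ b' → 0 ≤ c' →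
      2 ^ 15 * ((d : ℝ) + 1) ^ 2 * ((d : ℝ) + 4) ^ 2 * (L : ℝ) ^ 2 * b' ≤ 1 →
      23040 * (d : ℝ) ^ 4 * (frameC d L + d) ^ 3 * (c' + curConst d L * b' ^ 2) ≤ 1 →
      ∀ ⦃ε s₁ b : ℝ⦄, 0 < ε → ε ≤ r → 0 ≤ s₁ → s₁ ≤ r → 0 ≤ b → b ≤ ε / 2 →
      ∀ (s₂ β : ℝ) {dom : _root_.Set (Site d → Fin d → (Matrix n n ℂ)ˣ)},
        PairLandauGaugeB8Avg d (sfClass d L N ε) L N b g s₁ s₂ β dom →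
        LeafH3sup d L N ε b' c' dom →
        CovRootHolder d (sfClass d L N ε) L N b g C s₁ s₂ β dom := by
  have hd1 : 1 ≤ d := by omega
  have hd0 : (0 : ℝ) < d := by exact_mod_cast (show 0 < d by omega)
  have hd1r : (1 : ℝ) ≤ d := by exact_mod_cast hd1
  have hdm : (0 : ℝ) ≤ (d : ℝ) - 1 := by linarith
  have hcard : (0 : ℝ) < (Fintype.card n : ℝ) := by exact_mod_cast Fintype.card_pos
  -- the k-free slice constant (verbatim `…N16ConstantOfRecord` §4), with its sign `CP > 0`
  obtain ⟨δW, hδW⟩ : ∃ D : ℝ, D = (2 + 32 * (8 * (Fintype.card n : ℝ) * d * (1 + 2 * (((d : ℝ) - 1) * θ)) ^ 2 * (2 * (8 : ℝ) ^ d) ^ 2))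
      * (8 * (Fintype.card n : ℝ) * d * (1 + 2 * (((d : ℝ) - 1) * θ)) ^ 2 * (2 * (8 : ℝ) ^ d) ^ 2) := ⟨_, rfl⟩
  have hδW0 : 0 ≤ δW := by
    rw [hδW]
    have : 0 ≤ 1 + 2 * (((d : ℝ) - 1) * θ) := by have := mul_nonneg hdm hθ.le; linarith
    positivity
  have hCPL : 0 < CPLine d L (Fintype.card n) εc θ := CPLine_pos hd1 L hcard hεc.le hθ.le
  obtain ⟨CP, hCP⟩ : ∃ C : ℝ, C = 4 * (Fintype.card n : ℝ) * (69 + 2 * δW) * CPLine d L (Fintype.card n) εc θ := ⟨_, rfl⟩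
  have hCP0 : 0 < CP := by rw [hCP]; positivity
  obtain ⟨r, hr0, hr⟩ := covRootHolder_sfClass_small_of_leafH3sup_const (n := n) hd hL hN hCP0
  -- the ε-radii of the lines absorbed into `r`
  obtain ⟨A, hA⟩ : ∃ A : ℝ, A = 128 * (69 + 2 * δW) * CPLine d L (Fintype.card n) εc θ * (Fintype.card (Plane d) : ℝ) * (Fintype.card n : ℝ) := ⟨_, rfl⟩
  have hA0 : 0 ≤ A := by rw [hA]; positivity
  obtain ⟨B₁, hB₁⟩ : ∃ B : ℝ, B = 16 * (14464 * ((d : ℝ) + 1) ^ 2 * ((d : ℝ) + 4) ^ 2) := ⟨_, rfl⟩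
  have hB₁0 : 0 < B₁ := by rw [hB₁]; positivity
  obtain ⟨B₂, hB₂⟩ : ∃ B : ℝ, B = 2 * twoLevelSmall d L := ⟨_, rfl⟩
  have hB₂0 : 0 < B₂ := by rw [hB₂]; unfold twoLevelSmall; positivity
  obtain ⟨B₃, hB₃⟩ : ∃ B : ℝ, B = 512 * ((d : ℝ) + 1) * ((d : ℝ) + 4) * (L : ℝ) ^ 2 := ⟨_, rfl⟩
  have hB₃0 : 0 < B₃ := by rw [hB₃]; positivity
  obtain ⟨B₄, hB₄⟩ : ∃ B : ℝ, B = 226 * (8 * ((d : ℝ) + 1) * ((d : ℝ) + 4)) ^ 2 := ⟨_, rfl⟩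
  have hB₄0 : 0 < B₄ := by rw [hB₄]; positivity
  refine ⟨min r (min θ (min (1 / (A + 1)) (min (3 / B₁) (min ((L : ℝ) ^ 2 / B₂) (min (1 / B₃) (2 / B₄)))))),
    lt_min hr0 (lt_min hθ (lt_min (by positivity) (lt_min (by positivity) (lt_min (by positivity) (lt_min (by positivity) (by positivity)))))),
    fun g hg => ?_⟩
  refine ⟨((1 + ((1 + 2048 * Real.sqrt (16 * d + 1)) + 23 * Real.sqrt 2 * Real.sqrt (16 * d + 1) * (1 + (1 + 2048 * Real.sqrt (16 * d + 1)))))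
          * (8 * (Fintype.card n : ℝ) * (1 + 4 * CP) * (8 + 1 / (2 * CP)))
          * ((1 + Real.sqrt (192 * ((d : ℝ) * L) * (d + Fintype.card (T4AveragingDeficitWall.Plane d))))
            * (Real.sqrt ((L : ℝ) ^ (d - 2))
              + (Real.sqrt ((L : ℝ) ^ (d - 2)) * Real.sqrt (8 * Fintype.card (T4AveragingDeficitWall.Plane d)) * (128 * (d * (L : ℝ) ^ 2))
                  + 2 * (2048 * ((d : ℝ) + 4) ^ 2 * (L : ℝ) ^ 2 * Real.sqrt (d * (L : ℝ) ^ d))) / 2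
              + (2 * (L : ℝ) ^ (d - 1) + 2 * (8 * d * (L : ℝ) ^ d)) * Real.sqrt (d / (g * (L : ℝ) ^ (d + 2))) / 4))),
    ?_, fun b' c' hb' hc' hRb hcF ε s₁ b hε hεr hs₁ hs₁r hb hbh s₂ β dom hB8 h3L => ?_⟩
  · have := hCP0.le; positivity
  have hεr' : ε ≤ r := hεr.trans (min_le_left _ _)
  have hεθ : ε ≤ θ := hεr.trans ((min_le_right _ _).trans (min_le_left _ _))
  have hεA : ε ≤ 1 / (A + 1) := hεr.trans ((min_le_right _ _).trans ((min_le_right _ _).trans (min_le_left _ _)))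
  have hε1 : ε ≤ 3 / B₁ := hεr.trans ((min_le_right _ _).trans ((min_le_right _ _).trans ((min_le_right _ _).trans (min_le_left _ _))))
  have hε2 : ε ≤ (L : ℝ) ^ 2 / B₂ :=
    hεr.trans ((min_le_right _ _).trans ((min_le_right _ _).trans ((min_le_right _ _).trans ((min_le_right _ _).trans (min_le_left _ _)))))
  have hε3 : ε ≤ 1 / B₃ :=
    hεr.trans ((min_le_right _ _).trans ((min_le_right _ _).trans ((min_le_right _ _).trans ((min_le_right _ _).trans ((min_le_right _ _).trans (min_le_left _ _))))))
  have hε4 : ε ≤ 2 / B₄ :=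
    hεr.trans ((min_le_right _ _).trans ((min_le_right _ _).trans ((min_le_right _ _).trans ((min_le_right _ _).trans ((min_le_right _ _).trans (min_le_right _ _))))))
  have hs₁r' : s₁ ≤ r := hs₁r.trans (min_le_left _ _)
  -- the lines at this `ε`
  have hf1 : 16 * (14464 * ((d : ℝ) + 1) ^ 2 * ((d : ℝ) + 4) ^ 2) * ε ≤ 3 := by
    rw [← hB₁]; rw [le_div_iff₀ hB₁0] at hε1; linarith
  have hf2 : 2 * twoLevelSmall d L * ε ≤ (L : ℝ) ^ 2 := by
    rw [← hB₂]; rw [le_div_iff₀ hB₂0] at hε2; linarith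
  have hbs : 512 * (d + 1) * (d + 4) * (L : ℝ) ^ 2 * b ≤ 1 := by
    have h1' : B₃ * ε ≤ 1 := by rw [le_div_iff₀ hB₃0] at hε3; linarith
    have : B₃ * b ≤ B₃ * ε := mul_le_mul_of_nonneg_left (by linarith) hB₃0.le
    rw [hB₃] at this h1'
    linarith
  have hbε' : b + 226 * (8 * (d + 1) * (d + 4)) ^ 2 * b ^ 2 ≤ ε := by
    have hB4ε : B₄ * ε ≤ 2 := by rw [le_div_iff₀ hB₄0] at hε4; linarith
    have hb2 : b ^ 2 ≤ (ε / 2) ^ 2 := pow_le_pow_left₀ hb hbh 2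
    have : B₄ * b ^ 2 ≤ ε / 2 := by
      calc B₄ * b ^ 2 ≤ B₄ * (ε / 2) ^ 2 := mul_le_mul_of_nonneg_left hb2 hB₄0.le
        _ = (B₄ * ε) * ε / 4 := by ring
        _ ≤ 2 * ε / 4 := by
            have := mul_le_mul_of_nonneg_right hB4ε hε.le
            linarith
        _ = ε / 2 := by ring
    rw [hB₄] at this
    linarith
  have h6 : 128 * (69 + 2 * ((2 + 32 * (8 * (Fintype.card n : ℝ) * d * (1 + 2 * (((d : ℝ) - 1) * θ)) ^ 2 * (2 * (8 : ℝ) ^ d) ^ 2))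
              * (8 * (Fintype.card n : ℝ) * d * (1 + 2 * (((d : ℝ) - 1) * θ)) ^ 2 * (2 * (8 : ℝ) ^ d) ^ 2)))
        * CPLine d L (Fintype.card n) εc θ * (Fintype.card (Plane d) : ℝ) * (Fintype.card n : ℝ) * ε ^ 2 ≤ 1 := by
    rw [← hδW, ← hA]
    have hA1 : 0 < A + 1 := by linarith
    have hεA' : ε * (A + 1) ≤ 1 := by rwa [le_div_iff₀ hA1] at hεA
    have hε1' : ε ≤ 1 := by
      have : ε ≤ ε * (A + 1) := le_mul_of_one_le_right hε.le (by linarith)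
      linarith
    have t1 : A * ε * ε ≤ A * ε * 1 := mul_le_mul_of_nonneg_left hε1' (by positivity)
    have t2 : A * ε ≤ ε * (A + 1) := by linarith [hε.le]
    calc A * ε ^ 2 = A * ε * ε := by ring
      _ ≤ A * ε * 1 := t1
      _ = A * ε := by ring
      _ ≤ ε * (A + 1) := t2
      _ ≤ 1 := hεA'
  refine hr hg hb' hc' hRb hcF hε hεr' hs₁ hs₁r' hb hbh s₂ β hB8 h3L ?_
  intro j V _ UB _ hreg
  have hP := slicePoincare_slicB8_cavg_of_regular hd hL hN hb hε hεθ hεc hbs hbε' hf1 hf2 h1 h2 h3 h4 h6 j hreg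
  rw [← hδW, ← hCP] at hP
  exact hP

/-! ## §4 The `d = 4` instance: N16's CONSTANT OF RECORD at exponent `β` -/

/-- **N16 · THE CONSTANT OF RECORD AT HÖLDER EXPONENT `β`** (`d = 4`; `L ≥ 2`, `N ≥ 1`) — `N16.n16_constant_of_record` with `1 ↦ β`: there is `r > 0` depending on
`(L, N, n)` ONLY such that for every regularity letter `g > 0` there is ONE constant `C ≥ 0` depending on `(L, N, n, g)` ONLY such that for all leaf letters `0 ≤ b′, c′`
on (Rb) and the `c′`-line, every class radius `0 < ε ≤ r`, B8 constant `0 ≤ s₁ ≤ r`, regularity `0 ≤ b ≤ ε∕2`, every `s₂`, EVERY EXPONENT `β` and every `dom`: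
`PairLandauGaugeB8Avg 4 (sfClass 4 L N ε) L N b g s₁ s₂ β dom` (N05: [Balaban1985RegularSpaces] Thm 2 + (1.37) at the pair, Hölder member at exponent `β` — printed
for `β ≤ β₀ < 1`) and `LeafH3sup 4 L N ε b′ c′ dom` (N07) imply `CovRootHolder 4 (sfClass 4 L N ε) L N b g C s₁ s₂ β dom` (= `N16HolderAt`'s body).  At `β := 1`
this is `n16_constant_of_record` (`covRootHolder_one_iff`).  N16 ∕ NE3 NOT proved: the two interfaces are the hypotheses. [folklore] -/
theorem n16_holder_constant_of_record [Nonempty n] {L N : ℕ} (hL : 2 ≤ L) (hN : 1 ≤ N) :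
    ∃ r : ℝ, 0 < r ∧ ∀ ⦃g : ℝ⦄, 0 < g → ∃ C : ℝ, 0 ≤ C ∧ ∀ ⦃b' c' : ℝ⦄, 0 ≤ b' → 0 ≤ c' →
      2 ^ 15 * ((4 : ℝ) + 1) ^ 2 * ((4 : ℝ) + 4) ^ 2 * (L : ℝ) ^ 2 * b' ≤ 1 →
      23040 * (4 : ℝ) ^ 4 * (frameC 4 L + 4) ^ 3 * (c' + curConst 4 L * b' ^ 2) ≤ 1 →
      ∀ ⦃ε s₁ b : ℝ⦄, 0 < ε → ε ≤ r → 0 ≤ s₁ → s₁ ≤ r → 0 ≤ b → b ≤ ε / 2 →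
      ∀ (s₂ β : ℝ) {dom : _root_.Set (Site 4 → Fin 4 → (Matrix n n ℂ)ˣ)},
        PairLandauGaugeB8Avg 4 (sfClass 4 L N ε) L N b g s₁ s₂ β dom →
        LeafH3sup 4 L N ε b' c' dom →
        CovRootHolder 4 (sfClass 4 L N ε) L N b g C s₁ s₂ β dom := by
  haveI : NeZero L := NeZero.of_pos (by omega); haveI : NeZero N := NeZero.of_pos (by omega)
  obtain ⟨θ, εc, hθ, hεc, h1, h2, h3, h4⟩ := ownerLines_exist 4 (L := L) (by omega) (c := (Fintype.card n : ℝ)) (by positivity)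
  obtain ⟨r, hr0, hr⟩ := covRootHolder_sfClass_small_of_lines_const (d := 4) (n := n) (by norm_num) hL hN hθ hεc h1 h2 h3 h4
  refine ⟨r, hr0, fun g hg => ?_⟩
  obtain ⟨C, hC0, hC⟩ := hr hg
  refine ⟨C, hC0, fun b' c' hb' hc' hRb hcF => ?_⟩
  exact hC hb' hc' (by simpa only [Nat.cast_ofNat] using hRb) (by simpa only [Nat.cast_ofNat] using hcF)

/-- **… AND BACK TO THE RECORD AT `β = 1`**: §4 at exponent `1` returns `N16.n16_constant_of_record`'s conclusion (`covRootHolder_one_iff`). [folklore] -/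
theorem ne3EnergyRateWCov_of_holder_constant_one [Nonempty n] {L N : ℕ} (hL : 2 ≤ L) (hN : 1 ≤ N) :
    ∃ r : ℝ, 0 < r ∧ ∀ ⦃g : ℝ⦄, 0 < g → ∃ C : ℝ, 0 ≤ C ∧ ∀ ⦃b' c' : ℝ⦄, 0 ≤ b' → 0 ≤ c' →
      2 ^ 15 * ((4 : ℝ) + 1) ^ 2 * ((4 : ℝ) + 4) ^ 2 * (L : ℝ) ^ 2 * b' ≤ 1 →
      23040 * (4 : ℝ) ^ 4 * (frameC 4 L + 4) ^ 3 * (c' + curConst 4 L * b' ^ 2) ≤ 1 →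
      ∀ ⦃ε s₁ b : ℝ⦄, 0 < ε → ε ≤ r → 0 ≤ s₁ → s₁ ≤ r → 0 ≤ b → b ≤ ε / 2 →
      ∀ (s₂ : ℝ) {dom : _root_.Set (Site 4 → Fin 4 → (Matrix n n ℂ)ˣ)},
        PairLandauGaugeB8Avg 4 (sfClass 4 L N ε) L N b g s₁ s₂ 1 dom →
        LeafH3sup 4 L N ε b' c' dom →
        NE3EnergyWeightedCovShape.NE3EnergyRateWCov 4 (sfClass 4 L N ε) L N b g C s₁ s₂ dom := by
  obtain ⟨r, hr0, hr⟩ := n16_holder_constant_of_record (n := n) hL hN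
  refine ⟨r, hr0, fun g hg => ?_⟩
  obtain ⟨C, hC0, hC⟩ := hr hg
  refine ⟨C, hC0, fun b' c' hb' hc' hRb hcF ε s₁ b hε hεr hs₁ hs₁r hb hbh s₂ dom hB8 h3 => ?_⟩
  exact N16HolderDefs.covRootHolder_one_iff.mp (hC hb' hc' hRb hcF hε hεr hs₁ hs₁r hb hbh s₂ 1 hB8 h3)

end

end Summit.QuantumFields.YangMills.BalabanUVNodes.N16HolderConst
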